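import Literature.AnabelianGeometry.SemiGraphs.GraphOfAnabelioidsLimits
import Literature.AnabelianGeometry.Anabelioids.GaloisImages

/-!
# Complements of subobjects in the category `B(𝒢)` of a semi-graph of anabelioids

Proof-only companion of `GraphOfAnabelioids.lean` ([SemiAnbd] Def. 2.1 p. 23), third part of the
named fact `bOf_galoisCategory`: axiom (G3) for `B(𝒢)` — every monomorphism `i : X ⟶ Y` of `B(𝒢)`
is the inclusion of a direct summand, `Y ≅ X ⨿ Z`.  The complement is glued from the complements
`Z_v`, `Z_e` of the components `i_v`, `i_e` (which are monomorphisms, the restriction functors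
preserving pullbacks) in the constituent anabelioids: the pull-back functors `b^*` are exact, so
`b^* Z_v` and `Z_e` are both complements of the subobject `b^* X_v ≅ X_e ↪ Y_e`, and complements
in a Galois category are unique (`Anabelioids.complement_unique`).

Also: a morphism of `B(𝒢)` is a monomorphism iff all its components are
(`mono_fS`, `mono_fT`, `mono_of_components`).
-/

namespace Literature.AnabelianGeometry.SemiGraphs

open CategoryTheory CategoryTheory.Limits CategoryTheory.PreGaloisCategory
open Literature.AnabelianGeometry.Anabelioids

universe v₁ u₁ u

namespace SemiGraphOfAnabelioids

variable (𝒢 : SemiGraphOfAnabelioids.{v₁, u₁, u})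

/-- The vertex components of a monomorphism of `B(𝒢)` are monomorphisms (the restriction functor
`ρ_v` preserves pullbacks). [cite: MochizukiSemiAnbd2006, Def. 2.1 p.23] -/
theorem mono_fS {X Y : 𝒢.BObj} (i : X ⟶ Y) [Mono i] (v : 𝒢.graph.Vertex) : Mono (i.fS v) := by
  have := (𝒢.hasLimitsOfShape_bObj (J := WalkingCospan)).2.1 v
  exact (𝒢.ρ v).map_mono i

/-- The edge components of a monomorphism of `B(𝒢)` are monomorphisms (the restriction functor
`ρ_e` preserves pullbacks). [cite: MochizukiSemiAnbd2006, Def. 2.1 p.23] -/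
theorem mono_fT {X Y : 𝒢.BObj} (i : X ⟶ Y) [Mono i] (e : 𝒢.graph.Edge) : Mono (i.fT e) := by
  have := (𝒢.hasLimitsOfShape_bObj (J := WalkingCospan)).2.2 e
  exact (𝒢.ρE e).map_mono i

variable {𝒢} in
/-- A morphism of `B(𝒢)` all of whose components are monomorphisms is a monomorphism.
[cite: MochizukiSemiAnbd2006, Def. 2.1 p.23] -/
theorem mono_of_components {X Y : 𝒢.BObj} (i : X ⟶ Y) (hS : ∀ v, Mono (i.fS v))
    (hT : ∀ e, Mono (i.fT e)) : Mono i :=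
  ⟨fun _ _ hg => BObj.hom_ext _ _
    (funext fun v => (cancel_mono (i.fS v)).mp (congrArg (fun f => BObj.Hom.fS f v) hg))
    (funext fun e => (cancel_mono (i.fT e)).mp (congrArg (fun f => BObj.Hom.fT f e) hg))⟩

variable {𝒢} in
/-- A morphism of `B(𝒢)` all of whose components are epimorphisms is an epimorphism.
[cite: MochizukiSemiAnbd2006, Def. 2.1 p.23] -/
theorem epi_of_components {X Y : 𝒢.BObj} (f : X ⟶ Y) (hS : ∀ v, Epi (f.fS v))
    (hT : ∀ e, Epi (f.fT e)) : Epi f :=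
  ⟨fun _ _ hg => BObj.hom_ext _ _
    (funext fun v => (cancel_epi (f.fS v)).mp (congrArg (fun f => BObj.Hom.fS f v) hg))
    (funext fun e => (cancel_epi (f.fT e)).mp (congrArg (fun f => BObj.Hom.fT f e) hg))⟩

/-- **Axiom (G3) for `B(𝒢)`** ([SemiAnbd] p. 23, part of "one verifies immediately that `B(𝒢)` is
a connected anabelioid"): a monomorphism `i : X ⟶ Y` of `B(𝒢)` is the inclusion of a direct
summand — there are `Z` and `u : Z ⟶ Y` with `Y = X ⨿ Z`.  The complement is glued from the
complements of the components using uniqueness of complements in the constituent Galois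
categories. [cite: MochizukiSemiAnbd2006, Def. 2.1 p.23] -/
theorem exists_complement {X Y : 𝒢.BObj} (i : X ⟶ Y) [Mono i] :
    ∃ (Z : 𝒢.BObj) (u : Z ⟶ Y), Nonempty (IsColimit (BinaryCofan.mk i u)) := by
  haveI := 𝒢.mono_fS i
  haveI := 𝒢.mono_fT i
  -- complements of the components
  have hv := fun v => PreGaloisCategory.monoInducesIsoOnDirectSummand (i.fS v)
  have he := fun e => PreGaloisCategory.monoInducesIsoOnDirectSummand (i.fT e)
  choose ZS uS hZS using hv
  choose ZT uT hZT using he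
  have cS := fun v => (hZS v).some
  have cT := fun e => (hZT e).some
  -- gluing isomorphisms `b^* Z_v ≅ Z_e`
  have hγ : ∀ (b : 𝒢.graph.Branch) (v : 𝒢.graph.Vertex) (h : 𝒢.graph.abuts b = some v),
      ∃ γ : (𝒢.pull b v h).pullback.obj (ZS v) ≅ ZT (𝒢.graph.edgeOf b),
        (𝒢.pull b v h).pullback.map (uS v) ≫ (Y.ψ b v h).hom = γ.hom ≫ uT (𝒢.graph.edgeOf b) := by
    intro b v h
    -- `b^*` of the decomposition `Y_v = X_v ⨿ Z_v`, transported along `ψ_b : b^* Y_v ≅ Y_e`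
    have h1 : IsColimit (BinaryCofan.mk ((𝒢.pull b v h).pullback.map (i.fS v))
        ((𝒢.pull b v h).pullback.map (uS v))) :=
      mapIsColimitOfPreservesOfIsColimit _ _ _ (cS v)
    have h2 : IsColimit (BinaryCofan.mk
        ((𝒢.pull b v h).pullback.map (i.fS v) ≫ (Y.ψ b v h).hom)
        ((𝒢.pull b v h).pullback.map (uS v) ≫ (Y.ψ b v h).hom)) :=
      h1.ofIsoColimit (BinaryCofan.ext (Y.ψ b v h) rfl rfl)
    exact complement_unique _ _ (i.fT (𝒢.graph.edgeOf b)) (uT (𝒢.graph.edgeOf b)) h2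
      (cT (𝒢.graph.edgeOf b)) (X.ψ b v h) (i.comm b v h)
  choose γ hγ using hγ
  let Z : 𝒢.BObj := { S := ZS, T := ZT, ψ := γ }
  let u : Z ⟶ Y := { fS := uS, fT := uT, comm := hγ }
  refine ⟨Z, u, ⟨BinaryCofan.IsColimit.mk _ (fun {W} f g => ?_) (fun f g => ?_) (fun f g => ?_)
    (fun f g m hm₁ hm₂ => ?_)⟩⟩
  · -- the componentwise coproduct map
    refine
      { fS := fun v => (BinaryCofan.IsColimit.desc' (cS v) (f.fS v) (g.fS v)).1
        fT := fun e => (BinaryCofan.IsColimit.desc' (cT e) (f.fT e) (g.fT e)).1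
        comm := fun b v h => ?_ }
    apply BinaryCofan.IsColimit.hom_ext
      (mapIsColimitOfPreservesOfIsColimit (𝒢.pull b v h).pullback _ _ (cS v))
    · have e1 : i.fS v ≫ (BinaryCofan.IsColimit.desc' (cS v) (f.fS v) (g.fS v)).1 = f.fS v :=
        (BinaryCofan.IsColimit.desc' (cS v) (f.fS v) (g.fS v)).2.1
      have e2 : i.fT (𝒢.graph.edgeOf b) ≫ (BinaryCofan.IsColimit.desc' (cT (𝒢.graph.edgeOf b))
          (f.fT (𝒢.graph.edgeOf b)) (g.fT (𝒢.graph.edgeOf b))).1 = f.fT (𝒢.graph.edgeOf b) :=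
        (BinaryCofan.IsColimit.desc' (cT (𝒢.graph.edgeOf b)) (f.fT (𝒢.graph.edgeOf b))
          (g.fT (𝒢.graph.edgeOf b))).2.1
      simp only [BinaryCofan.mk_inl]
      change (𝒢.pull b v h).pullback.map (i.fS v) ≫ (𝒢.pull b v h).pullback.map _ ≫ (W.ψ b v h).hom =
        (𝒢.pull b v h).pullback.map (i.fS v) ≫ (Y.ψ b v h).hom ≫ _
      rw [← Category.assoc, ← Functor.map_comp, e1, f.comm b v h, ← Category.assoc, i.comm b v h,
        Category.assoc, e2]
    · have e1 : uS v ≫ (BinaryCofan.IsColimit.desc' (cS v) (f.fS v) (g.fS v)).1 = g.fS v :=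
        (BinaryCofan.IsColimit.desc' (cS v) (f.fS v) (g.fS v)).2.2
      have e2 : uT (𝒢.graph.edgeOf b) ≫ (BinaryCofan.IsColimit.desc' (cT (𝒢.graph.edgeOf b))
          (f.fT (𝒢.graph.edgeOf b)) (g.fT (𝒢.graph.edgeOf b))).1 = g.fT (𝒢.graph.edgeOf b) :=
        (BinaryCofan.IsColimit.desc' (cT (𝒢.graph.edgeOf b)) (f.fT (𝒢.graph.edgeOf b))
          (g.fT (𝒢.graph.edgeOf b))).2.2
      simp only [BinaryCofan.mk_inr]
      change (𝒢.pull b v h).pullback.map (uS v) ≫ (𝒢.pull b v h).pullback.map _ ≫ (W.ψ b v h).hom =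
        (𝒢.pull b v h).pullback.map (uS v) ≫ (Y.ψ b v h).hom ≫ _
      rw [← Category.assoc, ← Functor.map_comp, e1, g.comm b v h, ← Category.assoc, hγ b v h,
        Category.assoc, e2]
  · refine BObj.hom_ext _ _ (funext fun v => ?_) (funext fun e => ?_)
    · exact (BinaryCofan.IsColimit.desc' (cS v) (f.fS v) (g.fS v)).2.1
    · exact (BinaryCofan.IsColimit.desc' (cT e) (f.fT e) (g.fT e)).2.1
  · refine BObj.hom_ext _ _ (funext fun v => ?_) (funext fun e => ?_)
    · exact (BinaryCofan.IsColimit.desc' (cS v) (f.fS v) (g.fS v)).2.2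
    · exact (BinaryCofan.IsColimit.desc' (cT e) (f.fT e) (g.fT e)).2.2
  · refine BObj.hom_ext _ _ (funext fun v => ?_) (funext fun e => ?_)
    · apply BinaryCofan.IsColimit.hom_ext (cS v)
      · rw [(BinaryCofan.IsColimit.desc' (cS v) (f.fS v) (g.fS v)).2.1]
        exact congrArg (fun k => BObj.Hom.fS k v) hm₁
      · rw [(BinaryCofan.IsColimit.desc' (cS v) (f.fS v) (g.fS v)).2.2]
        exact congrArg (fun k => BObj.Hom.fS k v) hm₂
    · apply BinaryCofan.IsColimit.hom_ext (cT e)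
      · rw [(BinaryCofan.IsColimit.desc' (cT e) (f.fT e) (g.fT e)).2.1]
        exact congrArg (fun k => BObj.Hom.fT k e) hm₁
      · rw [(BinaryCofan.IsColimit.desc' (cT e) (f.fT e) (g.fT e)).2.2]
        exact congrArg (fun k => BObj.Hom.fT k e) hm₂

/-- `B(𝒢)` satisfies axiom (G3) in Mathlib's form.
[cite: MochizukiSemiAnbd2006, Def. 2.1 p.23] -/
theorem monoInducesIsoOnDirectSummand_bObj {X Y : 𝒢.BObj} (i : X ⟶ Y) [Mono i] :
    ∃ (Z : 𝒢.BObj) (u : Z ⟶ Y), Nonempty (IsColimit (BinaryCofan.mk i u)) :=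
  𝒢.exists_complement i

end SemiGraphOfAnabelioids

end Literature.AnabelianGeometry.SemiGraphs
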